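import Mathlib
import HarnessLib

/-!
# `NoHeavyLowerTail` (crux stmt-CriticalPhenomena-4575), antithetic vdBHK programme: the TWISTED DOUBLE (decoration by a pendant edge)

Support file (seat `prim-ineq-gen-7` gen 21; `--supports stmt-CriticalPhenomena-4575`).  Nothing is asserted about the crux; no `sorry`,
no definitions.  Memo: run/shared/lean/prim/prim-ineq-gen-7/FINDING-GLUE-g21.md §3–4.

SETTING.  `(P, ≤)` finite preorder, weight `μ ≥ 0`, `ι` an antitone `μ`-preserving involution, `D ⊆ P` a down-set, `U := ι D`.  The *twisted
double* `X(P,D)` is `P × {R,B}` with `(s,c) ≤ (s',c')` iff `s ≤ s'` and [`c = c'`, or `c=R, c'=B, s ∈ D, s' ∈ U`, or `c=B, c'=R, s ∉ U, s' ∉ D`],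
involution `(s,c) ↦ (ι s, c̄)`.  PROPOSITION (memo §3, pencil + mechanical): adding a pendant edge at a non-terminal vertex `v` turns each of the
rooted-colouring posets RAA(Q;T), ULEX/LEX/MASTER⁺(Q;c,t) into such a twisted double (for RAA, `D = {v red-joined to T}`).  CONJECTURE TD (memo §4,
census-clean): `P` antipodal-Kleitman ⟹ `X(P,D)` antipodal-Kleitman for every down-set `D`.
This file avoids a new type for `X`: a monotone function on `X` is a pair `(f_R, f_B)` of monotone functions on `P` with the two cross
conditions, and the AK form of `X` is `Σ_s μ s [f_R s (g_R s − g_B (ι s)) + f_B s (g_B s − g_R (ι s))]`.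
* `AntitheticTwist.twistForm_eq_inner` — the AK form of `X` equals `⟨u, w⟩_μ` with `u = f_R − f_B ∘ ι`, `w = g_R − g_B ∘ ι` (two reindexings);
* `AntitheticTwist.cone_of_twistMonotone` — `u` is monotone and satisfies the CONE constraints
  `u p + u q ≤ 0` (`p q ∈ D`, `p ≤ ι q`) and `0 ≤ u p + u q` (`p q ∉ D`, `ι q ≤ p`);
* `AntitheticTwist.twist_ak_of_coneAcute` — **reduction**: if that cone is acute in `L²(μ)` then `X(P,D)` is AK (so TD ⟸ 'cone acute');
* `AntitheticTwist.coneAcute_of_comparable`, `AntitheticTwist.twist_ak_of_comparable` — the cone IS acute, hence `X(P,D)` is AK for every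
  down-set `D`, whenever every element of `P` is comparable with its antipode (orbitwise sign pinning; no use of AK of `P`).
-/

namespace Summit.CriticalPhenomena.PercolationContinuityZ3.Theorems

open Finset

namespace AntitheticTwist

variable {P : Type*} [Fintype P] [Preorder P]

omit [Preorder P] in
/-- The AK form of the twisted double equals the `μ`-inner product of `f_R − f_B ∘ ι` and `g_R − g_B ∘ ι` (for a `μ`-preserving involution `ι`).
[this work] -/
theorem twistForm_eq_inner (μ : P → ℝ) (ι : P → P) (hιι : Function.Involutive ι) (hμι : ∀ p, μ (ι p) = μ p)
    (fR fB gR gB : P → ℝ) :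
    ∑ s, μ s * (fR s * (gR s - gB (ι s)) + fB s * (gB s - gR (ι s)))
      = ∑ s, μ s * ((fR s - fB (ι s)) * (gR s - gB (ι s))) := by
  -- the two sums that need reindexing by ι
  have h1 : ∑ s, μ s * (fB (ι s) * gR s) = ∑ s, μ s * (fB s * gR (ι s)) := by
    have := Equiv.sum_comp (hιι.toPerm ι) (fun s => μ s * (fB s * gR (ι s)))
    simp only [Function.Involutive.coe_toPerm] at this
    rw [← this]
    refine Finset.sum_congr rfl (fun s _ => ?_)
    rw [hμι, hιι s]
  have h2 : ∑ s, μ s * (fB (ι s) * gB (ι s)) = ∑ s, μ s * (fB s * gB s) := by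
    have := Equiv.sum_comp (hιι.toPerm ι) (fun s => μ s * (fB s * gB s))
    simp only [Function.Involutive.coe_toPerm] at this
    rw [← this]
    refine Finset.sum_congr rfl (fun s _ => ?_)
    rw [hμι]
  have hr : ∑ s, μ s * ((fR s - fB (ι s)) * (gR s - gB (ι s)))
      = ∑ s, μ s * (fR s * (gR s - gB (ι s))) - ∑ s, μ s * (fB (ι s) * gR s) + ∑ s, μ s * (fB (ι s) * gB (ι s)) := by
    rw [← Finset.sum_sub_distrib, ← Finset.sum_add_distrib]
    refine Finset.sum_congr rfl (fun s _ => ?_)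
    ring
  have hl : ∑ s, μ s * (fR s * (gR s - gB (ι s)) + fB s * (gB s - gR (ι s)))
      = ∑ s, μ s * (fR s * (gR s - gB (ι s))) - ∑ s, μ s * (fB s * gR (ι s)) + ∑ s, μ s * (fB s * gB s) := by
    rw [← Finset.sum_sub_distrib, ← Finset.sum_add_distrib]
    refine Finset.sum_congr rfl (fun s _ => ?_)
    ring
  rw [hr, hl, h1, h2]

omit [Fintype P] in
/-- The function `u = f_R − f_B ∘ ι` attached to a monotone function `(f_R, f_B)` of the twisted double is monotone and lies in the cone
`𝒞_D`: `u p + u q ≤ 0` for `p, q ∈ D` with `p ≤ ι q`, and `0 ≤ u p + u q` for `p, q ∉ D` with `ι q ≤ p`. [this work] -/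
theorem cone_of_twistMonotone (ι : P → P) (hιι : Function.Involutive ι) (hι : ∀ p q : P, p ≤ q → ι q ≤ ι p)
    (D : P → Prop) (fR fB : P → ℝ) (hfR : Monotone fR) (hfB : Monotone fB)
    (hX1 : ∀ s s' : P, s ≤ s' → D s → D (ι s') → fR s ≤ fB s')
    (hX2 : ∀ s s' : P, s ≤ s' → ¬ D (ι s) → ¬ D s' → fB s ≤ fR s') :
    Monotone (fun p => fR p - fB (ι p)) ∧
    (∀ p q : P, D p → D q → p ≤ ι q → (fR p - fB (ι p)) + (fR q - fB (ι q)) ≤ 0) ∧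
    (∀ p q : P, ¬ D p → ¬ D q → ι q ≤ p → 0 ≤ (fR p - fB (ι p)) + (fR q - fB (ι q))) := by
  refine ⟨?_, ?_, ?_⟩
  · intro p q hpq
    have h1 := hfR hpq
    have h2 := hfB (hι p q hpq)
    simp only
    linarith
  · intro p q hp hq hpq
    have hqp : q ≤ ι p := by
      have h := hι p (ι q) hpq
      rw [hιι q] at h
      exact h
    have h1 : fR p ≤ fB (ι q) := hX1 p (ι q) hpq hp (by rw [hιι q]; exact hq)
    have h2 : fR q ≤ fB (ι p) := hX1 q (ι p) hqp hq (by rw [hιι p]; exact hp)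
    linarith
  · intro p q hp hq hqp
    have hpq : ι p ≤ q := by
      have h := hι (ι q) p hqp
      rw [hιι q] at h
      exact h
    have h1 : fB (ι q) ≤ fR p := hX2 (ι q) p hqp (by rw [hιι q]; exact hq) hp
    have h2 : fB (ι p) ≤ fR q := hX2 (ι p) q hpq (by rw [hιι p]; exact hp) hq
    linarith

/-- **Reduction (TD ⟸ cone acuteness).**  If the cone `𝒞_D` of monotone functions `u` with `u p + u q ≤ 0` (`p,q ∈ D`, `p ≤ ι q`) and
`0 ≤ u p + u q` (`p, q ∉ D`, `ι q ≤ p`) is acute in `L²(μ)`, then the twisted double `X(P,D)` is antipodal Kleitman: its AK form is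
nonnegative on every pair of monotone functions `(f_R,f_B)`, `(g_R,g_B)` of `X`. [this work] -/
theorem twist_ak_of_coneAcute (μ : P → ℝ) (ι : P → P) (hιι : Function.Involutive ι) (hμι : ∀ p, μ (ι p) = μ p)
    (hι : ∀ p q : P, p ≤ q → ι q ≤ ι p) (D : P → Prop)
    (hcone : ∀ u w : P → ℝ, Monotone u → Monotone w →
      (∀ p q : P, D p → D q → p ≤ ι q → u p + u q ≤ 0) → (∀ p q : P, ¬ D p → ¬ D q → ι q ≤ p → 0 ≤ u p + u q) →
      (∀ p q : P, D p → D q → p ≤ ι q → w p + w q ≤ 0) → (∀ p q : P, ¬ D p → ¬ D q → ι q ≤ p → 0 ≤ w p + w q) →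
      0 ≤ ∑ p, μ p * (u p * w p))
    (fR fB gR gB : P → ℝ) (hfR : Monotone fR) (hfB : Monotone fB) (hgR : Monotone gR) (hgB : Monotone gB)
    (hfX1 : ∀ s s' : P, s ≤ s' → D s → D (ι s') → fR s ≤ fB s') (hfX2 : ∀ s s' : P, s ≤ s' → ¬ D (ι s) → ¬ D s' → fB s ≤ fR s')
    (hgX1 : ∀ s s' : P, s ≤ s' → D s → D (ι s') → gR s ≤ gB s') (hgX2 : ∀ s s' : P, s ≤ s' → ¬ D (ι s) → ¬ D s' → gB s ≤ gR s') :
    0 ≤ ∑ s, μ s * (fR s * (gR s - gB (ι s)) + fB s * (gB s - gR (ι s))) := by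
  rw [twistForm_eq_inner μ ι hιι hμι fR fB gR gB]
  obtain ⟨hum, hu1, hu2⟩ := cone_of_twistMonotone ι hιι hι D fR fB hfR hfB hfX1 hfX2
  obtain ⟨hwm, hw1, hw2⟩ := cone_of_twistMonotone ι hιι hι D gR gB hgR hgB hgX1 hgX2
  exact hcone (fun p => fR p - fB (ι p)) (fun p => gR p - gB (ι p)) hum hwm hu1 hu2 hw1 hw2

omit [Fintype P] in
/-- Orbitwise sign pinning: if `p ≤ ι p` then `u p * w p + u (ι p) * w (ι p) ≥ 0` for `u, w` in the cone `𝒞_D` (`D` a down-set).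
[this work] -/
theorem orbit_nonneg_of_le (ι : P → P) (hιι : Function.Involutive ι) (D : P → Prop) (hD : ∀ p q : P, p ≤ q → D q → D p)
    (u w : P → ℝ) (hu : Monotone u) (hw : Monotone w)
    (hu1 : ∀ p q : P, D p → D q → p ≤ ι q → u p + u q ≤ 0) (hu2 : ∀ p q : P, ¬ D p → ¬ D q → ι q ≤ p → 0 ≤ u p + u q)
    (hw1 : ∀ p q : P, D p → D q → p ≤ ι q → w p + w q ≤ 0) (hw2 : ∀ p q : P, ¬ D p → ¬ D q → ι q ≤ p → 0 ≤ w p + w q)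
    (p : P) (hp : p ≤ ι p) :
    0 ≤ u p * w p + u (ι p) * w (ι p) := by
  have hup : u p ≤ u (ι p) := hu hp
  have hwp : w p ≤ w (ι p) := hw hp
  by_cases hDp : D p
  · by_cases hDq : D (ι p)
    · -- both in D: u p ≤ -|u (ι p)|, same for w
      have hs : u p + u (ι p) ≤ 0 := hu1 p (ι p) hDp hDq (by rw [hιι p])
      have ht : w p + w (ι p) ≤ 0 := hw1 p (ι p) hDp hDq (by rw [hιι p])
      have ha : -u p ≥ |u (ι p)| := by
        rw [ge_iff_le, abs_le]; constructor <;> linarith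
      have hb : -w p ≥ |w (ι p)| := by
        rw [ge_iff_le, abs_le]; constructor <;> linarith
      have hprod : |u (ι p)| * |w (ι p)| ≤ (-u p) * (-w p) :=
        mul_le_mul ha hb (abs_nonneg _) (le_trans (abs_nonneg _) ha)
      have habs : -(u (ι p) * w (ι p)) ≤ |u (ι p)| * |w (ι p)| := by
        rw [← abs_mul]; exact neg_le_abs _
      nlinarith
    · -- p ∈ D, ι p ∉ D: u p ≤ 0 ≤ u (ι p)
      have hs : u p + u p ≤ 0 := hu1 p p hDp hDp hp
      have ht : w p + w p ≤ 0 := hw1 p p hDp hDp hp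
      have hs' : 0 ≤ u (ι p) + u (ι p) := hu2 (ι p) (ι p) hDq hDq (by rw [hιι p]; exact hp)
      have ht' : 0 ≤ w (ι p) + w (ι p) := hw2 (ι p) (ι p) hDq hDq (by rw [hιι p]; exact hp)
      have e1 : 0 ≤ u p * w p := mul_nonneg_of_nonpos_of_nonpos (by linarith) (by linarith)
      have e2 : 0 ≤ u (ι p) * w (ι p) := mul_nonneg (by linarith) (by linarith)
      linarith
  · have hDq : ¬ D (ι p) := fun h => hDp (hD p (ι p) hp h)
    -- both outside D: u (ι p) ≥ |u p|
    have hs : 0 ≤ u (ι p) + u p := hu2 (ι p) p hDq hDp (le_refl _)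
    have ht : 0 ≤ w (ι p) + w p := hw2 (ι p) p hDq hDp (le_refl _)
    have ha : |u p| ≤ u (ι p) := by
      rw [abs_le]; constructor <;> linarith
    have hb : |w p| ≤ w (ι p) := by
      rw [abs_le]; constructor <;> linarith
    have hprod : |u p| * |w p| ≤ u (ι p) * w (ι p) := mul_le_mul ha hb (abs_nonneg _) (le_trans (abs_nonneg _) ha)
    have habs : -(u p * w p) ≤ |u p| * |w p| := by
      rw [← abs_mul]; exact neg_le_abs _
    linarith

/-- **The cone is acute when every element is comparable with its antipode.**  For such `(P, ι)` (e.g. chains), `μ ≥ 0` `ι`-invariant and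
ANY down-set `D`: `Σ μ u w ≥ 0` for all `u, w` in the cone `𝒞_D`.  (Orbitwise pinning; the AK property of `P` is not even used.) [this work] -/
theorem coneAcute_of_comparable (μ : P → ℝ) (hμ : ∀ p, 0 ≤ μ p) (ι : P → P) (hιι : Function.Involutive ι) (hμι : ∀ p, μ (ι p) = μ p)
    (hcomp : ∀ p : P, p ≤ ι p ∨ ι p ≤ p) (D : P → Prop) (hD : ∀ p q : P, p ≤ q → D q → D p)
    (u w : P → ℝ) (hu : Monotone u) (hw : Monotone w)
    (hu1 : ∀ p q : P, D p → D q → p ≤ ι q → u p + u q ≤ 0) (hu2 : ∀ p q : P, ¬ D p → ¬ D q → ι q ≤ p → 0 ≤ u p + u q)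
    (hw1 : ∀ p q : P, D p → D q → p ≤ ι q → w p + w q ≤ 0) (hw2 : ∀ p q : P, ¬ D p → ¬ D q → ι q ≤ p → 0 ≤ w p + w q) :
    0 ≤ ∑ p, μ p * (u p * w p) := by
  -- orbit sums are nonnegative
  have horb : ∀ p : P, 0 ≤ u p * w p + u (ι p) * w (ι p) := by
    intro p
    rcases hcomp p with h | h
    · exact orbit_nonneg_of_le ι hιι D hD u w hu hw hu1 hu2 hw1 hw2 p h
    · have := orbit_nonneg_of_le ι hιι D hD u w hu hw hu1 hu2 hw1 hw2 (ι p) (by rw [hιι p]; exact h)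
      rw [hιι p] at this
      linarith
  -- 2 Σ μ u w = Σ μ (u w + (u w) ∘ ι)
  have hre : ∑ p, μ p * (u (ι p) * w (ι p)) = ∑ p, μ p * (u p * w p) := by
    have := Equiv.sum_comp (hιι.toPerm ι) (fun p => μ p * (u p * w p))
    simp only [Function.Involutive.coe_toPerm] at this
    rw [← this]
    refine Finset.sum_congr rfl (fun p _ => ?_)
    rw [hμι]
  have h2 : 2 * ∑ p, μ p * (u p * w p) = ∑ p, μ p * (u p * w p + u (ι p) * w (ι p)) := by
    calc 2 * ∑ p, μ p * (u p * w p) = ∑ p, μ p * (u p * w p) + ∑ p, μ p * (u (ι p) * w (ι p)) := by rw [hre]; ring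
      _ = ∑ p, μ p * (u p * w p + u (ι p) * w (ι p)) := by
          rw [← Finset.sum_add_distrib]
          exact Finset.sum_congr rfl (fun p _ => by ring)
  have h3 : 0 ≤ ∑ p, μ p * (u p * w p + u (ι p) * w (ι p)) :=
    Finset.sum_nonneg (fun p _ => mul_nonneg (hμ p) (horb p))
  linarith

/-- **TD for comparable orbits.**  If every element of `P` is comparable with its antipode, then the twisted double `X(P,D)` is antipodal
Kleitman for EVERY down-set `D` (AK form ≥ 0 on monotone pairs). [this work] -/
theorem twist_ak_of_comparable (μ : P → ℝ) (hμ : ∀ p, 0 ≤ μ p) (ι : P → P) (hιι : Function.Involutive ι) (hμι : ∀ p, μ (ι p) = μ p)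
    (hι : ∀ p q : P, p ≤ q → ι q ≤ ι p) (hcomp : ∀ p : P, p ≤ ι p ∨ ι p ≤ p) (D : P → Prop) (hD : ∀ p q : P, p ≤ q → D q → D p)
    (fR fB gR gB : P → ℝ) (hfR : Monotone fR) (hfB : Monotone fB) (hgR : Monotone gR) (hgB : Monotone gB)
    (hfX1 : ∀ s s' : P, s ≤ s' → D s → D (ι s') → fR s ≤ fB s') (hfX2 : ∀ s s' : P, s ≤ s' → ¬ D (ι s) → ¬ D s' → fB s ≤ fR s')
    (hgX1 : ∀ s s' : P, s ≤ s' → D s → D (ι s') → gR s ≤ gB s') (hgX2 : ∀ s s' : P, s ≤ s' → ¬ D (ι s) → ¬ D s' → gB s ≤ gR s') :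
    0 ≤ ∑ s, μ s * (fR s * (gR s - gB (ι s)) + fB s * (gB s - gR (ι s))) :=
  twist_ak_of_coneAcute μ ι hιι hμι hι D
    (fun u w hu hw hu1 hu2 hw1 hw2 => coneAcute_of_comparable μ hμ ι hιι hμι hcomp D hD u w hu hw hu1 hu2 hw1 hw2)
    fR fB gR gB hfR hfB hgR hgB hfX1 hfX2 hgX1 hgX2


/-! ### Separated twists (seat `prim-ineq-gen-7` gen 23; memo FINDING-SUN-g23.md §2)

If the down-set `D` is *separated* (`D ∩ ι D = ∅`) and *covering* (`D ∪ ι D = P`), the twisted double `X(P,D)` splits into the two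
`ι`-invariant halves `D×{R} ∪ ιD×{B}` and `D×{B} ∪ ιD×{R}`, each isomorphic to `P`; so its AK form is the sum of two AK forms of `P`
(no twist is left: the twist of `X(P,D)` lives on `D ∩ ιD` and on `P ∖ (D ∪ ιD)`).  In particular TD holds for such `D` as soon as `P` is
antipodal Kleitman.  Used in the memo to show that a fibre product `X(T_n; D_{k_1},…,D_{k_p})` minus its thin 'Z-layer' is a disjoint
union of `2^p` copies of one AK poset. -/

omit [Preorder P] in
/-- Pointwise splitting of the AK form of a twisted double along a separated covering down-set: with `h₁ = (f_R on D, f_B off D)` and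
`h₃ = (f_B on D, f_R off D)` (and likewise for `g`), the AK form of `X(P,D)` is the sum of the AK forms of `P` at `(h₁, h₁')` and
`(h₃, h₃')`. [this work] -/
theorem twistForm_eq_of_separated (μ : P → ℝ) (ι : P → P) (D : P → Prop) [DecidablePred D]
    (hsep : ∀ p, D p → ¬ D (ι p)) (hcov : ∀ p, D p ∨ D (ι p)) (fR fB gR gB : P → ℝ) :
    ∑ s, μ s * (fR s * (gR s - gB (ι s)) + fB s * (gB s - gR (ι s)))
      = ∑ s, μ s * ((fun p => if D p then fR p else fB p) s *
            ((fun p => if D p then gR p else gB p) s - (fun p => if D p then gR p else gB p) (ι s)))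
        + ∑ s, μ s * ((fun p => if D p then fB p else fR p) s *
            ((fun p => if D p then gB p else gR p) s - (fun p => if D p then gB p else gR p) (ι s))) := by
  rw [← Finset.sum_add_distrib]
  refine Finset.sum_congr rfl (fun s _ => ?_)
  by_cases hs : D s
  · have hi : ¬ D (ι s) := hsep s hs
    simp only [hs, hi, if_true, if_false]
    ring
  · have hi : D (ι s) := (hcov s).resolve_left hs
    simp only [hs, hi, if_true, if_false]
    ring

omit [Fintype P] in
/-- Along a separated covering down-set the 'straight' recombination `h₁ = (f_R on D, f_B off D)` of a monotone function `(f_R, f_B)` of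
the twisted double is monotone on `P`. [this work] -/
theorem monotone_straight_of_separated (ι : P → P) (D : P → Prop) [DecidablePred D]
    (hD : ∀ p q : P, p ≤ q → D q → D p) (hcov : ∀ p, D p ∨ D (ι p))
    (fR fB : P → ℝ) (hfR : Monotone fR) (hfB : Monotone fB)
    (hX1 : ∀ s s' : P, s ≤ s' → D s → D (ι s') → fR s ≤ fB s') :
    Monotone (fun p => if D p then fR p else fB p) := by
  intro s s' hss'
  simp only
  by_cases hs : D s
  · by_cases hs' : D s'
    · simp only [hs, hs', if_true]; exact hfR hss'
    · simp only [hs, hs', if_true, if_false]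
      exact hX1 s s' hss' hs ((hcov s').resolve_left hs')
  · have hs' : ¬ D s' := fun h => hs (hD s s' hss' h)
    simp only [hs, hs', if_false]; exact hfB hss'

omit [Fintype P] in
/-- Along a separated covering down-set the 'crossed' recombination `h₃ = (f_B on D, f_R off D)` of a monotone function `(f_R, f_B)` of
the twisted double is monotone on `P`. [this work] -/
theorem monotone_crossed_of_separated (ι : P → P) (D : P → Prop) [DecidablePred D]
    (hD : ∀ p q : P, p ≤ q → D q → D p) (hsep : ∀ p, D p → ¬ D (ι p))
    (fR fB : P → ℝ) (hfR : Monotone fR) (hfB : Monotone fB)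
    (hX2 : ∀ s s' : P, s ≤ s' → ¬ D (ι s) → ¬ D s' → fB s ≤ fR s') :
    Monotone (fun p => if D p then fB p else fR p) := by
  intro s s' hss'
  simp only
  by_cases hs : D s
  · by_cases hs' : D s'
    · simp only [hs, hs', if_true]; exact hfB hss'
    · simp only [hs, hs', if_true, if_false]
      exact hX2 s s' hss' (hsep s hs) hs'
  · have hs' : ¬ D s' := fun h => hs (hD s s' hss' h)
    simp only [hs, hs', if_false]; exact hfR hss'

/-- **TD for separated covering down-sets.**  If `D` is a down-set with `D ∩ ι D = ∅` and `D ∪ ι D = P`, then the twisted double `X(P,D)`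
is antipodal Kleitman whenever `P` is: its AK form is the sum of two AK forms of `P` (`twistForm_eq_of_separated`) evaluated at monotone
functions (`monotone_straight_of_separated`, `monotone_crossed_of_separated`).  No positivity or `ι`-invariance of `μ` is needed. [this work] -/
theorem twist_ak_of_separated (μ : P → ℝ) (ι : P → P) (D : P → Prop) [DecidablePred D]
    (hD : ∀ p q : P, p ≤ q → D q → D p) (hsep : ∀ p, D p → ¬ D (ι p)) (hcov : ∀ p, D p ∨ D (ι p))
    (hAK : ∀ f g : P → ℝ, Monotone f → Monotone g → 0 ≤ ∑ s, μ s * (f s * (g s - g (ι s))))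
    (fR fB gR gB : P → ℝ) (hfR : Monotone fR) (hfB : Monotone fB) (hgR : Monotone gR) (hgB : Monotone gB)
    (hfX1 : ∀ s s' : P, s ≤ s' → D s → D (ι s') → fR s ≤ fB s') (hfX2 : ∀ s s' : P, s ≤ s' → ¬ D (ι s) → ¬ D s' → fB s ≤ fR s')
    (hgX1 : ∀ s s' : P, s ≤ s' → D s → D (ι s') → gR s ≤ gB s') (hgX2 : ∀ s s' : P, s ≤ s' → ¬ D (ι s) → ¬ D s' → gB s ≤ gR s') :
    0 ≤ ∑ s, μ s * (fR s * (gR s - gB (ι s)) + fB s * (gB s - gR (ι s))) := by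
  rw [twistForm_eq_of_separated μ ι D hsep hcov fR fB gR gB]
  have h1 := hAK _ _ (monotone_straight_of_separated ι D hD hcov fR fB hfR hfB hfX1)
    (monotone_straight_of_separated ι D hD hcov gR gB hgR hgB hgX1)
  have h3 := hAK _ _ (monotone_crossed_of_separated ι D hD hsep fR fB hfR hfB hfX2)
    (monotone_crossed_of_separated ι D hD hsep gR gB hgR hgB hgX2)
  linarith

end AntitheticTwist

end Summit.CriticalPhenomena.PercolationContinuityZ3.Theorems
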